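/-
Origin: expansion seat `planner-pub-hodgecm-pv03-g5-0`, handover #3 2026-08-18T09:20:46Z (`HOME/pub-hodgecm-pv03-g5/lean/Pv03g5/ThetaGram.lean`, md5 6cc60b62, 1151 lines);
landed by the gen-7 packager in gate run 27 as `HodgeCM/Model/ToyG2/ThetaGram.lean` (import ^import Pv03g5\.→import HodgeCM.Model.ToyG2. ×1).
-/
import Mathlib
import Summits.HodgeConjecture.HodgeCM.Model.ToyG2.ThetaPeriod
import Summits.HodgeConjecture.HodgeCM.Model.ToyG2.BlockGram_2

/-!
# (R3-a) The Gram map `Λ` of the period leaf and the Gram identity `inner_Λ`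

Companion of `ThetaUiso` (R2-a) and `ThetaPeriod` (R1).  For the period block `P(L, ι₁) = ∏_q M_{Θ_q}` of
`toyUniverse₃ d t` this file realises the quadrilinear period on holomorphic one-forms as a GRAM MATRIX, with
toy-g2's positive block `BlockGram` (`BlockData`, `g`, `inner_self`, `inner_of_ne`, `g_sec_zero_eq_smul`,
`g_fst_ne_zero`) supplying the vectors:

* `blockData q` : the `BlockData (FK L →+* ℂ)` of block `q` — conjugation of characters, the four CM types
  `Θ_{q,i}`, the weights `s_{q,i}(τ) = Im τ(ξ_{q,i})` (`ξOf_re`, `ξOf_im_pos_iff`, `ξOf_prod`), the couplings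
  `β_k = ε_k · (t/4) · s₂ s₃` (`ε = (-1, 1, -1)`), and the cross coefficient `d`; the singular-kernel axiom
  `β² = (s₂ s₃)²` of `BlockData` is where **`t² = 16`** enters, `1 ≤ d` is the other standing hypothesis;
* `HG`, `Gv q u` : the Hilbert space `ℓ²(∐_q (W ⊕ (Fin 3 × E)))` and the Gram vectors of toy-g2's `g`, placed in
  block `q`; `inner_Gv` : `⟪Gv q' v, Gv q u⟫ = [q = q'] · ∑ₓ g u x · g v x`;
* `co q a τ` : the eigen-coordinate functionals on `H¹(P(L, ι₁), ℂ)` (`co_eCls` : dual to the single eigenvectors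
  `E_{q,a,τ}` of `ThetaUiso`);
* `Λ₀`, `Λ = Λ₀ - Λ₀.flip` : the bilinear, alternating Gram map `H¹ × H¹ → HG`; `Λ_eCls_eCls` : its values on
  pairs of single eigenvectors (`± Gv` on a holomorphic pair of one block in two different slots, `0` otherwise);
* `gram_eq_period` : toy-g2's Gram entries ARE the quadrilinear periods of holomorphic eigenvector pairs,
  `∑ₓ g u x g v x = ¼ · period(E_u, E'_u, E_v, E'_v)` (the `EigenForms` value table via `ThetaPeriod`, sorted by
  `AlternatingMap.map_perm`);
* `inner_Λ₃` : **the Gram identity** `⟪Λ ω₂ ω₃, Λ ω₀ ω₁⟫ = ¼ · period(ω₀, ω₁, ω₂, ω₃)` for all holomorphic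
  `ωᵢ ∈ H^{1,0}(P(L, ι₁))` (sesquilinear extension from the eigenvectors, `H10_eq_span₃`) — the field
  `ThetaRealisation.inner_Λ` for `toyUniverse₃ d t` with `c = 1/4`;
* `Λ_theta01_eq_smul`, `Λ_theta23_ne_zero` : the KERNEL RELATION
  `Λ(E_{q,0,θ}, E_{q,1,θ}) = κ_θ • Λ(E_{q,2,θ}, E_{q,3,θ})`
  and non-vanishing on the theta vectors (toy-g2 `g_sec_zero_eq_smul`, `g_fst_ne_zero`) — the inputs of
  `lineField` / `gen12` / `real34`.

Everything is kernel-proved from the tree; no citation, nothing posited.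
-/

open scoped TensorProduct InnerProductSpace
open HodgeCM.Toy HodgeCM.Toy.CMPresentation exteriorPower NumberField.ComplexEmbedding
open Literature.AlgebraicGeometry.Motives

namespace HodgeCM.ToyG2.ThetaUiso

noncomputable section

open scoped Classical

/-! ### §0 Shapes: the six slot pairs `a < b` of `Fin 4` as (couple, role) -/
section Shapes

/-- (Ported verbatim from the HodgeCMPerL package; no docstring in the source.) -/
theorem sh₁_lt_sh₂ (k : Fin 3) (r : Bool) : sh₁ k r < sh₂ k r := by
  revert k r; decide

/-- (Ported verbatim from the HodgeCMPerL package; no docstring in the source.) -/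
theorem sh_injective {k k' : Fin 3} {r r' : Bool} (h₁ : sh₁ k r = sh₁ k' r') (h₂ : sh₂ k r = sh₂ k' r') :
    k = k' ∧ r = r' := by
  revert k k' r r'; decide

/-- the (couple, role) of a slot pair `a < b` -/
def shapeOf (a b : Fin 4) : Fin 3 × Bool :=
  if a = 0 then (if b = 1 then (0, true) else if b = 2 then (1, false) else (2, false))
  else if a = 1 then (if b = 2 then (2, true) else (1, true))
  else (0, false)

/-- (Ported verbatim from the HodgeCMPerL package; no docstring in the source.) -/
theorem sh₁_shapeOf {a b : Fin 4} (h : a < b) : sh₁ (shapeOf a b).1 (shapeOf a b).2 = a := by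
  revert a b; decide

/-- (Ported verbatim from the HodgeCMPerL package; no docstring in the source.) -/
theorem sh₂_shapeOf {a b : Fin 4} (h : a < b) : sh₂ (shapeOf a b).1 (shapeOf a b).2 = b := by
  revert a b; decide

/-- (Ported verbatim from the HodgeCMPerL package; no docstring in the source.) -/
theorem shapeOf_sh (k : Fin 3) (r : Bool) : shapeOf (sh₁ k r) (sh₂ k r) = (k, r) := by
  revert k r; decide

end Shapes

/-! ### §1 The block data of block `q` of the leaf `P(L, ι₁)` -/
section Block

variable {L : CMField} (ι₁ : L →+* ℂ) (d t : ℚ)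

/-- the weight `s_{q,i}(τ) = Im τ(ξ_{q,i})` of a character `τ` of `F_L` -/
def sW (q : Fin (nQ L ι₁)) (i : Fin 4) (τ : FK L →+* ℂ) : ℝ := (τ (eK L (ξOf L ι₁ q i))).im

/-- (Ported verbatim from the HodgeCMPerL package; no docstring in the source.) -/
theorem emb_ξOf_eq (q : Fin (nQ L ι₁)) (i : Fin 4) (τ : FK L →+* ℂ) :
    τ (eK L (ξOf L ι₁ q i)) = (sW ι₁ q i τ : ℂ) * Complex.I := by
  have hre : (τ (eK L (ξOf L ι₁ q i))).re = 0 := ξOf_re L ι₁ q i (τ.comp (eK L : L →+* FK L))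
  apply Complex.ext
  · simp [hre]
  · simp [sW]

/-- (Ported verbatim from the HodgeCMPerL package; no docstring in the source.) -/
theorem conj_emb_ξOf (q : Fin (nQ L ι₁)) (i : Fin 4) (τ : FK L →+* ℂ) :
    (conjugate τ) (eK L (ξOf L ι₁ q i)) = -τ (eK L (ξOf L ι₁ q i)) := by
  rw [conjugate_coe_eq, emb_ξOf_eq]
  simp [Complex.conj_ofReal]

/-- (Ported verbatim from the HodgeCMPerL package; no docstring in the source.) -/
theorem sW_conjugate (q : Fin (nQ L ι₁)) (i : Fin 4) (τ : FK L →+* ℂ) :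
    sW ι₁ q i (conjugate τ) = -sW ι₁ q i τ := by
  simp only [sW, conjugate_coe_eq, Complex.conj_im]

/-- (Ported verbatim from the HodgeCMPerL package; no docstring in the source.) -/
theorem sW_pos_iff (q : Fin (nQ L ι₁)) (i : Fin 4) (τ : FK L →+* ℂ) :
    0 < sW ι₁ q i τ ↔ τ.comp (eK L : L →+* FK L) ∈ (ΘOf L ι₁ q i).1 :=
  ξOf_im_pos_iff L ι₁ q i (τ.comp (eK L : L →+* FK L))

/-- (Ported verbatim from the HodgeCMPerL package; no docstring in the source.) -/
theorem sW_mul (q : Fin (nQ L ι₁)) (τ : FK L →+* ℂ) :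
    sW ι₁ q 0 τ * sW ι₁ q 1 τ = sW ι₁ q 2 τ * sW ι₁ q 3 τ := by
  have h := congrArg (fun x => τ (eK L x)) (ξOf_prod L ι₁ q)
  simp only [map_mul, emb_ξOf_eq] at h
  have hI : Complex.I * Complex.I = -1 := Complex.I_mul_I
  have h2 : ((sW ι₁ q 0 τ * sW ι₁ q 1 τ : ℝ) : ℂ) = ((sW ι₁ q 2 τ * sW ι₁ q 3 τ : ℝ) : ℂ) := by
    push_cast
    linear_combination (-1 : ℂ) * h
      + ((sW ι₁ q 0 τ : ℂ) * (sW ι₁ q 1 τ : ℂ) - (sW ι₁ q 2 τ : ℂ) * (sW ι₁ q 3 τ : ℂ)) * hI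
  exact_mod_cast h2

/-- the signs `ε = (-1, 1, -1)` of the three couplings (from sorting `E_a ∧ E_b ∧ Ē_{a'} ∧ Ē_{b'}`) -/
def ε (k : Fin 3) : ℝ := if k = 1 then 1 else -1

/-- (Ported verbatim from the HodgeCMPerL package; no docstring in the source.) -/
theorem ε_sq (k : Fin 3) : ε k ^ 2 = 1 := by
  unfold ε; split_ifs <;> norm_num

/-- **the block data of block `q`** (toy-g2 `BlockGram.BlockData`) for the parameters `1 ≤ d`, `t² = 16` -/
def blockData (hd : (1 : ℚ) ≤ d) (ht : t ^ 2 = 16) (q : Fin (nQ L ι₁)) : BlockData (FK L →+* ℂ) where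
  c := conjugate
  Θ i := Finset.univ.filter fun τ => τ.comp (eK L : L →+* FK L) ∈ (ΘOf L ι₁ q i).1
  s := sW ι₁ q
  s_pos_iff i τ := by
    rw [Finset.mem_filter, sW_pos_iff]
    simp
  s_c i τ := sW_conjugate ι₁ q i τ
  s_mul τ := sW_mul ι₁ q τ
  β k τ := ε k * ((t : ℝ) / 4) * (sW ι₁ q 2 τ * sW ι₁ q 3 τ)
  β_sq k τ := by
    have ht' : ((t : ℝ) / 4) ^ 2 = 1 := by
      rw [div_pow, ← Rat.cast_pow, ht]; norm_num
    calc (ε k * ((t : ℝ) / 4) * (sW ι₁ q 2 τ * sW ι₁ q 3 τ)) ^ 2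
        = ε k ^ 2 * ((t : ℝ) / 4) ^ 2 * (sW ι₁ q 2 τ * sW ι₁ q 3 τ) ^ 2 := by ring
      _ = (sW ι₁ q 2 τ * sW ι₁ q 3 τ) ^ 2 := by rw [ε_sq, ht', one_mul, one_mul]
  d := d
  one_le_d := by exact_mod_cast hd

variable (hd : (1 : ℚ) ≤ d) (ht : t ^ 2 = 16)

/-- (Ported verbatim from the HodgeCMPerL package; no docstring in the source.) -/
theorem blockData_valid_iff (q : Fin (nQ L ι₁)) (u : W (FK L →+* ℂ)) :
    (blockData ι₁ d t hd ht q).valid u ↔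
      (u.2.2.1.comp (eK L : L →+* FK L) ∈ (ΘOf L ι₁ q (sh₁ u.1 u.2.1)).1 ∧
        u.2.2.2.comp (eK L : L →+* FK L) ∈ (ΘOf L ι₁ q (sh₂ u.1 u.2.1)).1) := by
  simp [BlockData.valid, blockData]

/-! ### §2 The Hilbert space and the Gram vectors -/

/-- the index set of the orthonormal basis of `HG`: a block, then toy-g2's `W ⊕ (Fin 3 × E)` -/
abbrev HGIdx (L : CMField) (ι₁ : L →+* ℂ) : Type :=
  Fin (nQ L ι₁) × (W (FK L →+* ℂ) ⊕ (Fin 3 × (FK L →+* ℂ)))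

/-- **the Hilbert space** `HG = ℓ²_ℂ(∐_q (W ⊕ (Fin 3 × E)))` -/
abbrev HG (L : CMField) (ι₁ : L →+* ℂ) : Type := EuclideanSpace ℂ (HGIdx L ι₁)

/-- the Gram vector of the pair-index `u` of block `q` (toy-g2 `BlockData.g`, real, placed in block `q`) -/
def Gv (q : Fin (nQ L ι₁)) (u : W (FK L →+* ℂ)) : HG L ι₁ :=
  WithLp.toLp 2 fun p => if p.1 = q then (((blockData ι₁ d t hd ht q).g u p.2 : ℝ) : ℂ) else 0

/-- (Ported verbatim from the HodgeCMPerL package; no docstring in the source.) -/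
theorem Gv_apply (q : Fin (nQ L ι₁)) (u : W (FK L →+* ℂ)) (p : HGIdx L ι₁) :
    Gv ι₁ d t hd ht q u p = if p.1 = q then (((blockData ι₁ d t hd ht q).g u p.2 : ℝ) : ℂ) else 0 := rfl

/-- `⟪Gv q' v, Gv q u⟫ = [q = q'] ∑ₓ g u x g v x` -/
theorem inner_Gv (q q' : Fin (nQ L ι₁)) (u v : W (FK L →+* ℂ)) :
    ⟪Gv ι₁ d t hd ht q' v, Gv ι₁ d t hd ht q u⟫_ℂ
      = if q = q' then
          ((∑ x, (blockData ι₁ d t hd ht q).g u x * (blockData ι₁ d t hd ht q).g v x : ℝ) : ℂ)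
        else 0 := by
  rw [PiLp.inner_apply, Fintype.sum_prod_type]
  simp only [Gv_apply, RCLike.inner_apply]
  by_cases h : q = q'
  · subst h
    rw [if_pos rfl, Finset.sum_eq_single q]
    · push_cast
      refine Finset.sum_congr rfl fun x _ => ?_
      simp [Complex.conj_ofReal]
    · intro q'' _ hq''
      simp [hq'']
    · simp
  · rw [if_neg h]
    refine Finset.sum_eq_zero fun q'' _ => Finset.sum_eq_zero fun x _ => ?_
    by_cases h1 : q'' = q'
    · have h2 : q'' ≠ q := fun e => h (e.symm.trans h1)
      rw [if_neg h2, zero_mul]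
    · rw [if_neg h1, map_zero, mul_zero]

end Block

/-! ### §3 Eigen-coordinates and the Gram map `Λ` -/
section Gram

variable {L : CMField} (ι₁ : L →+* ℂ) (d t : ℚ)

/-- `H¹(P(L, ι₁), ℂ) = ℂ ⊗ ⋀¹ L(P(L, ι₁))` (the type of `(toyUniverse₃ d t).CohC (pms L ι₁ V Γ) 1`, by `rfl`) -/
abbrev V1 : Type := ℂ ⊗[ℚ] ↥(⋀[ℚ]^1 (PO ι₁ d t).L)

/-- `(oneEquiv)_ℂ : ℂ ⊗ ⋀¹ L → ℂ ⊗ L`, the inverse of `form1` -/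
def oneC : V1 ι₁ d t →ₗ[ℂ] (PO ι₁ d t).LC := (oneEquiv ℚ (PO ι₁ d t).L).toLinearMap.baseChange ℂ

/-- (Ported verbatim from the HodgeCMPerL package; no docstring in the source.) -/
theorem oneC_form1 (x : (PO ι₁ d t).LC) : oneC ι₁ d t ((PO ι₁ d t).form1 x) = x := by
  unfold oneC Obj.form1
  rw [← LinearMap.comp_apply, ← LinearMap.baseChange_comp, LinearEquiv.comp_symm, LinearMap.baseChange_id,
    LinearMap.id_apply]

/-- (Ported verbatim from the HodgeCMPerL package; no docstring in the source.) -/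
theorem ix_eq_ix_iff (Θ : Fin 4 → CMType L) {τ τ' : FK L →+* ℂ} {a a' : Fin 4} :
    ix L Θ τ a = ix L Θ τ' a' ↔ a = a' ∧ τ = τ' := by
  constructor
  · intro h
    have h1 : a = a' :=
      slot_injective L Θ (by rw [← ix_fst L Θ τ a, ← ix_fst L Θ τ' a', h])
    subst h1
    refine ⟨rfl, ?_⟩
    fin_cases a <;> simp only [ix, Sigma.mk.injEq, heq_eq_eq, true_and] at h <;> exact h
  · rintro ⟨rfl, rfl⟩
    rfl

/-- **the eigen-coordinate** `co_{q,a,τ} : H¹(P(L, ι₁), ℂ) → ℂ`, the coefficient of `E_{q,a,τ}` -/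
def co (q : Fin (nQ L ι₁)) (a : Fin 4) (τ : FK L →+* ℂ) : V1 ι₁ d t →ₗ[ℂ] ℂ :=
  (PP L (ΘOf L ι₁ q)).eB.coord (ix L (ΘOf L ι₁ q) τ a) ∘ₗ (leafProj ι₁ d t q).baseChange ℂ ∘ₗ oneC ι₁ d t

/-- the eigen-coordinates are dual to the single eigenvectors -/
theorem co_eCls (q q' : Fin (nQ L ι₁)) (a a' : Fin 4) (τ τ' : FK L →+* ℂ) :
    co ι₁ d t q a τ (eCls ι₁ d t q' a' τ') = if q' = q ∧ a' = a ∧ τ' = τ then 1 else 0 := by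
  simp only [co, LinearMap.comp_apply, eCls_eq_form1, oneC_form1, eVec_eq]
  by_cases hq : q' = q
  · subst hq
    rw [leafProj_baseChange_leafIncl_self, Module.Basis.coord_apply, Module.Basis.repr_self,
      Finsupp.single_apply]
    simp only [ix_eq_ix_iff, true_and]
  · rw [leafProj_baseChange_leafIncl_of_ne ι₁ d t (fun e => hq e.symm), map_zero, if_neg (fun h => hq h.1)]

variable (hd : (1 : ℚ) ≤ d) (ht : t ^ 2 = 16)

/-- the coordinate product `ω ⊗ ω' ↦ co_{q,a_u,θ_u}(ω) · co_{q,b_u,θ'_u}(ω')` of the pair-index `u` of block `q` -/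
def pairCo (q : Fin (nQ L ι₁)) (u : W (FK L →+* ℂ)) : V1 ι₁ d t →ₗ[ℂ] V1 ι₁ d t →ₗ[ℂ] ℂ :=
  (LinearMap.mul ℂ ℂ).compl₁₂ (co ι₁ d t q (sh₁ u.1 u.2.1) u.2.2.1) (co ι₁ d t q (sh₂ u.1 u.2.1) u.2.2.2)

/-- the non-alternating Gram map `Λ₀(ω, ω') = ∑_q ∑_{u valid} co_{a_u,θ_u}(ω) co_{b_u,θ'_u}(ω') · Gv_q(u)` -/
def Λ₀ : V1 ι₁ d t →ₗ[ℂ] V1 ι₁ d t →ₗ[ℂ] HG L ι₁ :=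
  ∑ q : Fin (nQ L ι₁), ∑ u ∈ Finset.univ.filter (fun u => (blockData ι₁ d t hd ht q).valid u),
    (pairCo ι₁ d t q u).compr₂ (LinearMap.toSpanSingleton ℂ (HG L ι₁) (Gv ι₁ d t hd ht q u))

/-- **the Gram map** `Λ = Λ₀ - Λ₀ᵗ : H¹ × H¹ → HG`, bilinear and alternating -/
def Λ : V1 ι₁ d t →ₗ[ℂ] V1 ι₁ d t →ₗ[ℂ] HG L ι₁ := Λ₀ ι₁ d t hd ht - (Λ₀ ι₁ d t hd ht).flip

/-- (Ported verbatim from the HodgeCMPerL package; no docstring in the source.) -/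
theorem Λ₀_apply (ω ω' : V1 ι₁ d t) :
    Λ₀ ι₁ d t hd ht ω ω' = ∑ q : Fin (nQ L ι₁),
      ∑ u ∈ Finset.univ.filter (fun u => (blockData ι₁ d t hd ht q).valid u),
        (co ι₁ d t q (sh₁ u.1 u.2.1) u.2.2.1 ω * co ι₁ d t q (sh₂ u.1 u.2.1) u.2.2.2 ω')
          • Gv ι₁ d t hd ht q u := by
  simp only [Λ₀, LinearMap.coe_sum, Finset.sum_apply, LinearMap.compr₂_apply, pairCo,
    LinearMap.compl₁₂_apply, LinearMap.mul_apply', LinearMap.toSpanSingleton_apply]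

/-- (Ported verbatim from the HodgeCMPerL package; no docstring in the source.) -/
theorem Λ_apply (ω ω' : V1 ι₁ d t) :
    Λ ι₁ d t hd ht ω ω' = Λ₀ ι₁ d t hd ht ω ω' - Λ₀ ι₁ d t hd ht ω' ω := by
  simp only [Λ, LinearMap.sub_apply, LinearMap.flip_apply]

/-- (Ported verbatim from the HodgeCMPerL package; no docstring in the source.) -/
theorem Λ_self (ω : V1 ι₁ d t) : Λ ι₁ d t hd ht ω ω = 0 := by
  rw [Λ_apply, sub_self]

/-- (Ported verbatim from the HodgeCMPerL package; no docstring in the source.) -/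
theorem Λ_swap (ω ω' : V1 ι₁ d t) : Λ ι₁ d t hd ht ω' ω = -Λ ι₁ d t hd ht ω ω' := by
  rw [Λ_apply, Λ_apply, neg_sub]

/-- the pair-index of two characters in the slots `a < b` -/
def mkW (a b : Fin 4) (χ χ' : FK L →+* ℂ) : W (FK L →+* ℂ) := ((shapeOf a b).1, (shapeOf a b).2, χ, χ')

/-- (Ported verbatim from the HodgeCMPerL package; no docstring in the source.) -/
theorem mkW_sh (u : W (FK L →+* ℂ)) : mkW (sh₁ u.1 u.2.1) (sh₂ u.1 u.2.1) u.2.2.1 u.2.2.2 = u := by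
  obtain ⟨k, r, θ, θ'⟩ := u
  simp only [mkW, shapeOf_sh]

/-- `Λ₀` on two single eigenvectors: the Gram vector of their pair-index if they lie in ONE block, in slots
`a < b`, and are both holomorphic; `0` otherwise -/
theorem Λ₀_eCls_eCls (q₀ q₁ : Fin (nQ L ι₁)) (a b : Fin 4) (χ χ' : FK L →+* ℂ) :
    Λ₀ ι₁ d t hd ht (eCls ι₁ d t q₀ a χ) (eCls ι₁ d t q₁ b χ')
      = if q₁ = q₀ ∧ a < b ∧ (blockData ι₁ d t hd ht q₀).valid (mkW a b χ χ')
        then Gv ι₁ d t hd ht q₀ (mkW a b χ χ') else 0 := by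
  rw [Λ₀_apply]
  have hterm : ∀ (q : Fin (nQ L ι₁)) (u : W (FK L →+* ℂ)),
      (co ι₁ d t q (sh₁ u.1 u.2.1) u.2.2.1 (eCls ι₁ d t q₀ a χ)
        * co ι₁ d t q (sh₂ u.1 u.2.1) u.2.2.2 (eCls ι₁ d t q₁ b χ')) • Gv ι₁ d t hd ht q u
        = if q = q₀ ∧ (q₁ = q₀ ∧ a < b ∧ u = mkW a b χ χ') then Gv ι₁ d t hd ht q₀ u else 0 := by
    intro q u
    rw [co_eCls, co_eCls]
    by_cases h : q = q₀ ∧ (q₁ = q₀ ∧ a < b ∧ u = mkW a b χ χ')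
    · obtain ⟨rfl, rfl, hab, rfl⟩ := h
      rw [if_pos ⟨rfl, (sh₁_shapeOf hab).symm, rfl⟩, if_pos ⟨rfl, (sh₂_shapeOf hab).symm, rfl⟩, one_mul,
        one_smul, if_pos ⟨rfl, rfl, hab, rfl⟩]
    · rw [if_neg h]
      by_cases h1 : q₀ = q ∧ a = sh₁ u.1 u.2.1 ∧ χ = u.2.2.1
      · by_cases h2 : q₁ = q ∧ b = sh₂ u.1 u.2.1 ∧ χ' = u.2.2.2
        · exfalso
          apply h
          obtain ⟨rfl, ha, hχ⟩ := h1
          obtain ⟨hq, hb, hχ'⟩ := h2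
          refine ⟨rfl, hq, ?_, ?_⟩
          · rw [ha, hb]; exact sh₁_lt_sh₂ _ _
          · rw [ha, hb, hχ, hχ', mkW_sh]
        · rw [if_neg h2, mul_zero, zero_smul]
      · rw [if_neg h1, zero_mul, zero_smul]
  simp_rw [hterm]
  rw [Finset.sum_eq_single q₀]
  · by_cases hc : q₁ = q₀ ∧ a < b
    · have h1 : ∀ u : W (FK L →+* ℂ),
          (if q₀ = q₀ ∧ (q₁ = q₀ ∧ a < b ∧ u = mkW a b χ χ') then Gv ι₁ d t hd ht q₀ u else 0)
            = if u = mkW a b χ χ' then Gv ι₁ d t hd ht q₀ u else 0 := by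
        intro u
        simp only [hc, true_and]
      rw [Finset.sum_congr rfl (fun u _ => h1 u), Finset.sum_ite_eq']
      simp only [Finset.mem_filter, Finset.mem_univ, true_and, hc]
    · have h1 : ∀ u : W (FK L →+* ℂ),
          (if q₀ = q₀ ∧ (q₁ = q₀ ∧ a < b ∧ u = mkW a b χ χ') then Gv ι₁ d t hd ht q₀ u else 0) = 0 := by
        intro u
        rw [if_neg (fun h => hc ⟨h.2.1, h.2.2.1⟩)]
      rw [Finset.sum_congr rfl (fun u _ => h1 u), Finset.sum_const_zero, if_neg (fun h => hc ⟨h.1, h.2.1⟩)]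
  · intro q _ hq
    exact Finset.sum_eq_zero fun u _ => if_neg fun h => hq h.1
  · intro h
    exact absurd (Finset.mem_univ q₀) h

/-- **`Λ` on two single eigenvectors.** -/
theorem Λ_eCls_eCls (q₀ q₁ : Fin (nQ L ι₁)) (a b : Fin 4) (χ χ' : FK L →+* ℂ) :
    Λ ι₁ d t hd ht (eCls ι₁ d t q₀ a χ) (eCls ι₁ d t q₁ b χ')
      = (if q₁ = q₀ ∧ a < b ∧ (blockData ι₁ d t hd ht q₀).valid (mkW a b χ χ')
          then Gv ι₁ d t hd ht q₀ (mkW a b χ χ') else 0)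
        - (if q₀ = q₁ ∧ b < a ∧ (blockData ι₁ d t hd ht q₁).valid (mkW b a χ' χ)
          then Gv ι₁ d t hd ht q₁ (mkW b a χ' χ) else 0) := by
  rw [Λ_apply, Λ₀_eCls_eCls, Λ₀_eCls_eCls]

end Gram

/-! ### §4 The Gram entries are the periods of holomorphic eigenvector pairs -/
section Entries

variable {L : CMField} (ι₁ : L →+* ℂ) (d t : ℚ) (q : Fin (nQ L ι₁))

/-- (Ported verbatim from the HodgeCMPerL package; no docstring in the source.) -/
theorem conjugate_conjugate' (φ : FK L →+* ℂ) : conjugate (conjugate φ) = φ :=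
  RingHom.ext fun x => by simp []

/-- (Ported verbatim from the HodgeCMPerL package; no docstring in the source.) -/
theorem conjugate_inj' {φ ψ : FK L →+* ℂ} : conjugate φ = conjugate ψ ↔ φ = ψ :=
  ⟨fun h => by rw [← conjugate_conjugate' φ, h, conjugate_conjugate'], fun h => by rw [h]⟩

/-- (Ported verbatim from the HodgeCMPerL package; no docstring in the source.) -/
theorem emb_ξOf_mul (θ : FK L →+* ℂ) :
    θ (eK L (ξOf L ι₁ q 2 * ξOf L ι₁ q 3)) = -((sW ι₁ q 2 θ * sW ι₁ q 3 θ : ℝ) : ℂ) := by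
  rw [map_mul, map_mul, emb_ξOf_eq, emb_ξOf_eq]
  have hI : Complex.I * Complex.I = -1 := Complex.I_mul_I
  push_cast
  linear_combination ((sW ι₁ q 2 θ : ℂ) * (sW ι₁ q 3 θ : ℂ)) * hI

/-- (Ported verbatim from the HodgeCMPerL package; no docstring in the source.) -/
theorem conj_emb_ξOf_mul (θ : FK L →+* ℂ) :
    (conjugate θ) (eK L (ξOf L ι₁ q 2 * ξOf L ι₁ q 3)) = -((sW ι₁ q 2 θ * sW ι₁ q 3 θ : ℝ) : ℂ) := by
  rw [emb_ξOf_mul, sW_conjugate, sW_conjugate, neg_mul_neg]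

/-- (Ported verbatim from the HodgeCMPerL package; no docstring in the source.) -/
theorem ellCoef_sh (k : Fin 3) (r : Bool) :
    ellCoef d (sh₁ k r) (sh₂ k r) = if k = 0 then 1 else d := by
  fin_cases k <;> cases r <;> simp [ellCoef, sh₁, sh₂]


-- port_pkg: scope closed for this part
end Entries
end
end HodgeCM.ToyG2.ThetaUiso
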